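import Summits.ResolutionOfSingularities.ResolutionOfSingularities.Theorems.HilbertSamuelEliminationSigmaMaxModificationsCorridor3HypersurfacePoints
import Mathlib.RingTheory.Filtration
import Mathlib.RingTheory.KrullDimension.Regular
import Mathlib.RingTheory.Localization.AtPrime.Basic
import Mathlib.RingTheory.Localization.Ideal
import HarnessLib

/-!
# [OURS · L1 W4.2] D18 G4: «NEAR ⇒ ORDER» for hypersurface local rings — equal Hilbert functions force equal orders of the equations;
# the local rings of `R[X]/(h)` at primes are hypersurface quotients `R[X]_𝔔/(h)`
# (cell res-hironaka, LADDER-RESOLUTION rung L; slot W4.2, crux chain w42 `SigmaMaxModificationsCorridor3` stmt-ResolutionOfSingularities-19249;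
# `--supports stmt-ResolutionOfSingularities-19249 --as helper`; res-L1-w42-plan-1 GO F-74 12:34:43Z «HS ⇒ order bookkeeping»; hand res-D-brk-3
# (gen 6), cut G4 of TAKING 13:03:41Z; G1–G3 = p534278, p536675, p537948)

PURE COMMUTATIVE ALGEBRA, 0 `def`s, every declaration PROVED; OURS bookkeeping; NOT a statement of Hironaka's manuscript [Hironaka2017] nor of
[CossartJannsenSaito2020]/[CossartPiltant2019]. AI-written, weaker than expert review.

WHY. Along a canonical near step the Hilbert function `H^{(0)}` of the local ring does not change (tree
`Moving.hilbertFun_stalk_eq_of_canonicalNearStep`, `…Corridor3PsiStable`), and a flat local `𝔪 ↦ 𝔪` presentation does not change it either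
(`Literature…hilbertFun_eq_of_flat_of_map_maximalIdeal_eq`). So the CP-frame hypersurface `R[X]_𝔐/(h)` at `x_n` (order `m`) and the chart
hypersurface `S[X']_{𝔔}/(h')` at `x'` have the same Hilbert function. This file turns that into the NearShape input «`h'` has order `≥ m` at
`𝔔`» (p529392 `exists_frame_translate_localization_of_order`):

* `exists_mem_pow_not_mem_pow_succ` — the ORDER of a non-zero element of a Noetherian local ring (Krull).
* **`mem_pow_of_hilbertFun_quotient_eq`** — for regular local rings `S₁, S₂` of the same dimension and non-zero `g₁ ∈ 𝔪₁^m`, `g₂ ∈ 𝔪₂` with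
  `S₁/(g₁)`, `S₂/(g₂)` local and `H^{(0)}(S₁/(g₁)) = H^{(0)}(S₂/(g₂))`: `g₂ ∈ 𝔪₂^m` (H1′ `stub_H1_hilbertFun_quotient_span_singleton` on both sides,
  `hypersurfaceHFe e` injective in the multiplicity).
* `mem_pow_of_hilbertFun_quotient_eq_of_ringKrullDim_quotient_eq` — the same with the dimension hypothesis on the QUOTIENTS (`dim S = dim S/(g) + 1`,
  Mathlib `ringKrullDim_quotient_span_singleton_succ_eq_ringKrullDim`), the form read off `dim 𝒪_{x'} = dim 𝒪_{x_n}` (tree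
  `Moving.ringKrullDim_stalk_eq_of_canonicalNearStep`).
* `exists_ringEquiv_localization_quotient` — LOCALISATION COMMUTES WITH QUOTIENTS at a prime: for `Q` a prime of `R/I` and `P` its preimage,
  `(R/I)_Q ≅ R_P/I R_P` (Mathlib's instance `IsLocalization (algebraMapSubmonoid (R/I) P.primeCompl) (R_P/I R_P)`);
  `exists_ringEquiv_quotient_localization_of_isLocalRing` — for `R/I` LOCAL: `R/I ≅ R_P/I R_P`, `P` the preimage of its maximal ideal.
  Read with `R = R[X]`, `I = (h)`: the CP-frame ring `R[X]/(h)` and the chart ring `(S[X']/(h'))_𝔔` are hypersurface quotients of the regular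
  local rings `R[X]_𝔐`, `S[X']_𝔔` — the shape `stub_H1_hilbertFun_quotient_span_singleton` wants.

References: CJS LNM 2270 §2.2, Thm. 2.3 [CossartJannsenSaito2020]; Matsumura Thm. 8.10 (Krull), §14 [Matsumura1987]; tree `…Corridor3HypersurfacePoints`
(p-file of res-type-0xx: `hypersurfaceHFe_injective`), `…Corridor3HypersurfaceHilbertFunction` (`stub_H1_hilbertFun_quotient_span_singleton`).
-/

noncomputable section

set_option linter.dupNamespace false

open IsLocalRing IsLocalization
open Literature.RingTheory.HilbertSamuel Literature.AlgebraicGeometry.Resolution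

universe u

namespace Summit.ResolutionOfSingularities.ResolutionOfSingularities.Theorems.SigmaMaxModificationsCorridor3.Helpers

/-! ## The order of an element of a Noetherian local ring -/

/-- **Order of a non-zero element**: in a Noetherian local ring every `g ≠ 0` lies in `𝔪^μ ∖ 𝔪^{μ+1}` for a unique `μ` (Krull's intersection
theorem `⋂ 𝔪ⁿ = 0`). [cite: Matsumura1987, Thm. 8.10] -/
theorem exists_mem_pow_not_mem_pow_succ {A : Type*} [CommRing A] [IsLocalRing A] [IsNoetherianRing A] {g : A} (hg : g ≠ 0) :
    ∃ μ : ℕ, g ∈ maximalIdeal A ^ μ ∧ g ∉ maximalIdeal A ^ (μ + 1) := by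
  classical
  have hex : ∃ n : ℕ, g ∉ maximalIdeal A ^ n := by
    by_contra hall
    simp only [not_exists, not_not] at hall
    have hmem : g ∈ ⨅ n : ℕ, maximalIdeal A ^ n := Ideal.mem_iInf.mpr hall
    rw [Ideal.iInf_pow_eq_bot_of_isLocalRing _ (maximalIdeal.isMaximal A).ne_top, Ideal.mem_bot] at hmem
    exact hg hmem
  have h0 : Nat.find hex ≠ 0 := by
    intro h
    have := Nat.find_spec hex
    rw [h, pow_zero, Ideal.one_eq_top] at this
    exact this Submodule.mem_top
  refine ⟨Nat.find hex - 1, ?_, ?_⟩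
  · have := Nat.find_min hex (m := Nat.find hex - 1) (by omega)
    simpa using this
  · rw [Nat.sub_add_cancel (Nat.pos_of_ne_zero h0)]
    exact Nat.find_spec hex

/-! ## Equal Hilbert functions of hypersurface quotients force equal orders -/

/-- [OURS · L1 W4.2] **NEAR ⇒ ORDER.** Let `S₁, S₂` be regular local rings of the same dimension, `0 ≠ g₁ ∈ 𝔪₁^m`, `0 ≠ g₂ ∈ 𝔪₂`, with
`S₁/(g₁)` and `S₂/(g₂)` local rings having the same Hilbert function `H^{(0)}`. Then `g₂ ∈ 𝔪₂^m`: the orders `μ₁ ≥ m`, `μ₂` of `g₁`, `g₂` give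
`H^{(0)} = hypersurfaceHFe e μ₁ = hypersurfaceHFe e μ₂` (H1′), and `hypersurfaceHFe e` is injective. [cite: CossartJannsenSaito2020, Thm. 2.3, §2.2] -/
theorem mem_pow_of_hilbertFun_quotient_eq {S₁ S₂ : Type u} [CommRing S₁] [CommRing S₂] [IsRegularLocalRing S₁] [IsRegularLocalRing S₂]
    (hdim : ringKrullDim S₁ = ringKrullDim S₂) {m : ℕ} {g₁ : S₁} {g₂ : S₂} (hg₁0 : g₁ ≠ 0) (hg₁ : g₁ ∈ maximalIdeal S₁ ^ m)
    (hg₂0 : g₂ ≠ 0) (hg₂ : g₂ ∈ maximalIdeal S₂) [IsLocalRing (S₁ ⧸ Ideal.span {g₁})] [IsLocalRing (S₂ ⧸ Ideal.span {g₂})]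
    (hH : hilbertFun (S₁ ⧸ Ideal.span {g₁}) = hilbertFun (S₂ ⧸ Ideal.span {g₂})) :
    g₂ ∈ maximalIdeal S₂ ^ m := by
  obtain ⟨e, he⟩ : ∃ e : ℕ, ringKrullDim S₁ = e :=
    exists_nat_eq_of_ne_bot_of_ne_top ringKrullDim_ne_bot ringKrullDim_ne_top
  have he₂ : ringKrullDim S₂ = e := hdim ▸ he
  obtain ⟨μ₁, hμ₁, hμ₁'⟩ := exists_mem_pow_not_mem_pow_succ hg₁0
  obtain ⟨μ₂, hμ₂, hμ₂'⟩ := exists_mem_pow_not_mem_pow_succ hg₂0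
  have h1 := stub_H1_hilbertFun_quotient_span_singleton he hμ₁ hμ₁'
  have h2 := stub_H1_hilbertFun_quotient_span_singleton he₂ hμ₂ hμ₂'
  -- `e ≥ 1`: `g₂` is a non-zero element of `𝔪₂`
  have he1 : 1 ≤ e := by
    by_contra h0
    have hd : (maximalIdeal S₂).spanFinrank = 0 := by
      have h := IsRegularLocalRing.spanFinrank_maximalIdeal (R := S₂)
      rw [he₂] at h
      have h' : (maximalIdeal S₂).spanFinrank = e := by exact_mod_cast h
      omega
    have hbot : maximalIdeal S₂ = ⊥ :=
      (Submodule.spanFinrank_eq_zero_iff_eq_bot (IsNoetherian.noetherian (maximalIdeal S₂))).mp hd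
    rw [hbot, Ideal.mem_bot] at hg₂
    exact hg₂0 hg₂
  have hμ : μ₁ = μ₂ := hypersurfaceHFe_injective he1 (h1.symm.trans (hH.trans h2))
  -- `m ≤ μ₁`: otherwise `g₁ ∈ 𝔪^m ⊆ 𝔪^{μ₁+1}`
  have hmμ : m ≤ μ₁ := by
    by_contra hlt
    exact hμ₁' (Ideal.pow_le_pow_right (by omega) hg₁)
  exact Ideal.pow_le_pow_right (hμ ▸ hmμ) hμ₂

/-- [OURS · L1 W4.2] The same with the dimension hypothesis on the hypersurface quotients (`dim S/(g) + 1 = dim S` for a non-zero `g ∈ 𝔪` of a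
regular local ring — a domain). This is the form fed by `dim 𝒪_{X_{n+1},x'} = dim 𝒪_{X_n,x_n}` along a canonical near step.
[cite: CossartJannsenSaito2020, Thm. 2.3, §2.2] -/
theorem mem_pow_of_hilbertFun_quotient_eq_of_ringKrullDim_quotient_eq {S₁ S₂ : Type u} [CommRing S₁] [CommRing S₂]
    [IsRegularLocalRing S₁] [IsRegularLocalRing S₂] {m : ℕ} {g₁ : S₁} {g₂ : S₂} (hg₁0 : g₁ ≠ 0) (hg₁m : g₁ ∈ maximalIdeal S₁)
    (hg₁ : g₁ ∈ maximalIdeal S₁ ^ m) (hg₂0 : g₂ ≠ 0) (hg₂ : g₂ ∈ maximalIdeal S₂)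
    [IsLocalRing (S₁ ⧸ Ideal.span {g₁})] [IsLocalRing (S₂ ⧸ Ideal.span {g₂})]
    (hdim : ringKrullDim (S₁ ⧸ Ideal.span {g₁}) = ringKrullDim (S₂ ⧸ Ideal.span {g₂}))
    (hH : hilbertFun (S₁ ⧸ Ideal.span {g₁}) = hilbertFun (S₂ ⧸ Ideal.span {g₂})) :
    g₂ ∈ maximalIdeal S₂ ^ m := by
  haveI : IsDomain S₁ := isDomain_of_isRegularLocalRing S₁
  haveI : IsDomain S₂ := isDomain_of_isRegularLocalRing S₂
  have h1 := ringKrullDim_quotient_span_singleton_succ_eq_ringKrullDim_of_mem_nonZeroDivisors (mem_nonZeroDivisors_of_ne_zero hg₁0) hg₁m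
  have h2 := ringKrullDim_quotient_span_singleton_succ_eq_ringKrullDim_of_mem_nonZeroDivisors (mem_nonZeroDivisors_of_ne_zero hg₂0) hg₂
  refine mem_pow_of_hilbertFun_quotient_eq ?_ hg₁0 hg₁ hg₂0 hg₂ hH
  rw [← h1, ← h2, hdim]

/-! ## Localisation commutes with quotients: the local rings of `R/I` are hypersurface-type quotients of the local rings of `R` -/

/-- **`(R/I)_Q ≅ R_P/I·R_P`** for a prime `Q` of `R/I` with preimage `P` in `R`: Mathlib's «quotients commute with localisation» instance, the image
of `P ∖ P` in `R/I` being exactly `Q ∖ Q`, plus uniqueness of localisations. [folklore] -/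
theorem exists_ringEquiv_localization_quotient {R : Type u} [CommRing R] (I : Ideal R) (Q : Ideal (R ⧸ I)) [Q.IsPrime] :
    ∃ e : Localization.AtPrime Q ≃+*
        Localization.AtPrime (Q.comap (Ideal.Quotient.mk I)) ⧸ I.map (algebraMap R (Localization.AtPrime (Q.comap (Ideal.Quotient.mk I)))),
      ∀ r : R, e (algebraMap (R ⧸ I) (Localization.AtPrime Q) (Ideal.Quotient.mk I r)) =
        Ideal.Quotient.mk _ (algebraMap R (Localization.AtPrime (Q.comap (Ideal.Quotient.mk I))) r) := by
  set P := Q.comap (Ideal.Quotient.mk I) with hP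
  -- the image of `P.primeCompl` in `R/I` is `Q.primeCompl`
  have hM : Algebra.algebraMapSubmonoid (R ⧸ I) P.primeCompl = Q.primeCompl := by
    ext x
    constructor
    · rintro ⟨y, hy, rfl⟩
      exact fun hx => hy (Ideal.mem_comap.mpr hx)
    · intro hx
      obtain ⟨y, rfl⟩ := Ideal.Quotient.mk_surjective x
      exact ⟨y, fun hy => hx (Ideal.mem_comap.mp hy), rfl⟩
  have hloc : IsLocalization Q.primeCompl
      (Localization.AtPrime P ⧸ I.map (algebraMap R (Localization.AtPrime P))) := by
    have h : IsLocalization (Algebra.algebraMapSubmonoid (R ⧸ I) P.primeCompl)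
        (Localization.AtPrime P ⧸ I.map (algebraMap R (Localization.AtPrime P))) := inferInstance
    rwa [hM] at h
  refine ⟨(@IsLocalization.algEquiv (R ⧸ I) _ Q.primeCompl (Localization.AtPrime Q) _ _ _ _ _ _ hloc).toRingEquiv, fun r => ?_⟩
  change (@IsLocalization.algEquiv (R ⧸ I) _ Q.primeCompl (Localization.AtPrime Q) _ _ _ _ _ _ hloc) _ = _
  rw [AlgEquiv.commutes]
  rfl

/-- **For `R/I` LOCAL: `R/I ≅ R_P/I·R_P`**, `P` the preimage of the maximal ideal — `R/I` is its own localisation at the maximal ideal.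
[folklore] -/
theorem exists_ringEquiv_quotient_localization_of_isLocalRing {R : Type u} [CommRing R] (I : Ideal R) [IsLocalRing (R ⧸ I)] :
    ∃ e : (R ⧸ I) ≃+*
        Localization.AtPrime ((maximalIdeal (R ⧸ I)).comap (Ideal.Quotient.mk I)) ⧸
          I.map (algebraMap R (Localization.AtPrime ((maximalIdeal (R ⧸ I)).comap (Ideal.Quotient.mk I)))),
      ∀ r : R, e (Ideal.Quotient.mk I r) =
        Ideal.Quotient.mk _ (algebraMap R (Localization.AtPrime ((maximalIdeal (R ⧸ I)).comap (Ideal.Quotient.mk I))) r) := by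
  obtain ⟨e, he⟩ := exists_ringEquiv_localization_quotient I (maximalIdeal (R ⧸ I))
  let e₀ : (R ⧸ I) ≃ₐ[R ⧸ I] Localization.AtPrime (maximalIdeal (R ⧸ I)) :=
    IsLocalization.atUnits (R ⧸ I) (maximalIdeal (R ⧸ I)).primeCompl (S := Localization.AtPrime (maximalIdeal (R ⧸ I)))
      (fun x hx => (IsUnit.mem_submonoid_iff x).mpr
        (of_not_not fun hu => hx ((IsLocalRing.mem_maximalIdeal x).mpr (mem_nonunits_iff.mpr hu))))
  refine ⟨e₀.toRingEquiv.trans e, fun r => ?_⟩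
  rw [RingEquiv.trans_apply]
  change e (e₀ (algebraMap (R ⧸ I) (R ⧸ I) (Ideal.Quotient.mk I r))) = _
  rw [AlgEquiv.commutes]
  exact he r

end Summit.ResolutionOfSingularities.ResolutionOfSingularities.Theorems.SigmaMaxModificationsCorridor3.Helpers

end
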